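import Summits.HubbardSuperconductivity.HubbardSuperconductivity.Theses.InfiniteVolumeFirst
import Literature.MathematicalPhysics.QuantumLattice.HubbardTorusBlochCurrentBound
import Literature.MathematicalPhysics.QuantumLattice.HubbardTorusFlux

/-!
# Sketch — crux `NoInfraredPileUp` (stmt-HubbardSuperconductivity-18534), crux-ideate round 1, ideator 2

First lemmas of the two idea cards filed by planner-cruxidea-stmt-HubbardSuperconductivity-18534-2-0
(2026-08-17). Everything here elaborates; the two `theorem`s marked PROVED are sorry-free; nothing in
this file is filed as an item.

* §A  card `unit-norm-window-reward`: `WindowRewardStability` (the O(1)-norm flat window reward,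
      single-sector coercivity on the O(1) energy shell) and the PROVED ground-state evaluation
      `noInfraredPileUp_of_windowRewardStability : WindowRewardStability → NoInfraredPileUp`.
* §B  card `meissner-untwisting`: half `e₁`-kinetic weight `kinX`, minus half `e₁`-current `curX`,
      the PROVED continuous-flux pricing `fluxEnergy_le_twistRayleigh` (tree identity, rewritten on
      `fluxEnergy`), its PROVED optimisation over the real flux `fluxEnergy_le_of_current`
      (a unit sector vector carrying current `J̃` undercuts the flux envelope at SOME real flux by
      `2(√(K²+J̃²) − K) ≥ J̃²/(K+|J̃|)`), and the typed hypotheses `FluxDiamagnetism` (DIA) and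
      `LondonLockingOnShell` (LOCK).
-/

namespace Summit.HubbardSuperconductivity.HubbardSuperconductivity.Cruxes.NoInfraredPileUp.Ideator2

open Summit.HubbardSuperconductivity.HubbardSuperconductivity.Theses.InfiniteVolumeFirst
open Literature.MathematicalPhysics.QuantumLattice Literature.MathematicalPhysics.QuantumFieldTheory
  Literature.Probability.LatticeModels Matrix Finset Filter

noncomputable section

/-! ### Common abbreviations -/

/-- The window functional of the crux, `W_ε(φ) = Σ_{m ≠ 0, |q_m| ≤ ε} S_φ(m)` (quadratic in `φ`). -/
def windowSum (L : ℕ) [NeZero L] (ε : ℝ) (φ : Fock (Orb (FermionTorus 2 L))) : ℝ :=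
  ∑ m : Fin 2 → ZMod L, if m ≠ 0 ∧ momentumNormSq L m ≤ ε ^ 2 then
    pairStructureFactor dWaveFormFactor L φ m else 0

/-- The admissible sector `(N_L, S^z = 0)`, `N_L = 2⌊(1-δ)L²/2⌋`. -/
abbrev admSector (L : ℕ) (δ : ℝ) : Submodule ℂ (Fock (Orb (FermionTorus 2 L))) :=
  szSector (Λ := FermionTorus 2 L) (2 * ⌊(1 - δ) * (L : ℝ) ^ 2 / 2⌋₊) 0

/-! ### §A  The O(1)-norm flat window reward (card `unit-norm-window-reward`) -/

/-- **(FLAT_κ) WINDOW-REWARD STABILITY** — single-sector coercivity with VANISHING Kac coupling: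
for every `δ` there is `U₁ > 0` such that for all `U ∈ (0,U₁)` and every `η > 0` there are
`κ > 0`, `ε > 0`, `L₀` with, for all even `L ≥ L₀` and EVERY vector `φ` of the admissible sector,
`(κ/L²)·(W_ε(φ) − ηL²‖φ‖²) ≤ Re⟨φ,Hφ⟩ − E_L‖φ‖²`, `E_L = minEnergyOn`. Equivalently
`H − E_L ⪰ (κ/L²)(𝒲_ε − ηL²)` with `𝒲_ε = L⁻² Σ_window Δ_d(m)ᴴΔ_d(m)`, `‖𝒲_ε‖ ≤ 32L²` (Parseval), so the
perturbation `(κ/L²)𝒲_ε` has operator norm `≤ 32κ`: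
the sector ground energy of `H − (κ/L²)𝒲_ε` (Hubbard plus an O(1)-NORM flat `d`-wave attraction in
the window channels) lies within `κη` of `E_L` — the van den Berg–Lewis–Pulé response
characterisation of generalised condensation turned into an operator target. Content only on the
O(1) energy shell `Re⟨φ,(H−E_L)φ⟩ < 32κ`; pays the LSM-boost witness of `WallSoft.lean` iff
`κ ≲ 16π²k̄/a`. -/
def WindowRewardStability : Prop :=
  ∀ δ ∈ Set.Ioo (0:ℝ) (1 / 2), ∃ U₁ : ℝ, 0 < U₁ ∧ ∀ U ∈ Set.Ioo (0:ℝ) U₁,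
    ∀ η : ℝ, 0 < η → ∃ κ : ℝ, 0 < κ ∧ ∃ ε : ℝ, 0 < ε ∧ ∃ L₀ : ℕ, ∀ (L : ℕ) [NeZero L],
      Even L → L₀ ≤ L →
        ∀ φ : Fock (Orb (FermionTorus 2 L)), φ ∈ admSector L δ →
          κ / (L : ℝ) ^ 2 * (windowSum L ε φ - η * (L : ℝ) ^ 2 * (star φ ⬝ᵥ φ).re) ≤
            (star φ ⬝ᵥ (hubbardTorus 2 L 1 U *ᵥ φ)).re -
              (hubbardTorus 2 L 1 U).minEnergyOn (admSector L δ) * (star φ ⬝ᵥ φ).re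

/-- **Ground-state evaluation (PROVED)**: `WindowRewardStability → NoInfraredPileUp`. At a sector
ground state the right-hand side vanishes (`Hψ = E_L ψ`, `‖ψ‖ = 1`), so `W_ε(ψ) ≤ ηL²`. [folklore] -/
theorem noInfraredPileUp_of_windowRewardStability (h : WindowRewardStability) :
    NoInfraredPileUp := by
  intro δ hδ
  obtain ⟨U₁, hU₁, hU⟩ := h δ hδ
  refine ⟨U₁, hU₁, fun U hUm N ψ hadm η hη => ?_⟩
  obtain ⟨κ, hκ, ε, hε, L₀, hL⟩ := hU U hUm η hη
  refine ⟨ε, hε, L₀, fun L _ hLe hL₀ => ?_⟩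
  obtain ⟨hN, hψ1, hGS⟩ := hadm L hLe
  rw [hN] at hGS
  have key := hL L hLe hL₀ (ψ L) hGS.1
  have hE : (star (ψ L) ⬝ᵥ (hubbardTorus 2 L 1 U *ᵥ ψ L)).re =
      (hubbardTorus 2 L 1 U).minEnergyOn (admSector L δ) := by
    rw [hGS.2.2, dotProduct_smul, hψ1, smul_eq_mul, mul_one, Complex.ofReal_re]
  rw [hE, hψ1, Complex.one_re, mul_one, mul_one, sub_self] at key
  have hL2 : (0 : ℝ) < κ / (L : ℝ) ^ 2 := by
    have : (0 : ℝ) < (L : ℝ) := Nat.cast_pos.2 (Nat.pos_of_ne_zero (NeZero.ne L))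
    positivity
  have h0 : windowSum L ε (ψ L) - η * (L : ℝ) ^ 2 ≤ 0 := by
    by_contra hc
    push Not at hc
    exact absurd key (not_le.2 (mul_pos hL2 hc))
  have : windowSum L ε (ψ L) ≤ η * (L : ℝ) ^ 2 := by linarith
  simpa [windowSum] using this

/-! ### §B  Continuous-flux Meissner untwisting (card `meissner-untwisting`) -/

/-- Half the `e₁`-kinetic weight `K(φ) = Σ_{x,σ} Re⟨φ, c†_{x+e₁,σ}c_{x,σ} φ⟩` (notation of
`HubbardTorusBlochCurrentBound`). -/
def kinX {L : ℕ} [NeZero L] (φ : Fock (Orb (FermionTorus 2 L))) : ℝ :=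
  ∑ x : Site 2 L, ∑ σ : Fin 2,
    (star φ ⬝ᵥ ((creation (orb (FermionTorus.ofTorusSite (Site.shift x 0)) σ) *
      annihilation (orb (FermionTorus.ofTorusSite x) σ)) *ᵥ φ)).re

/-- Minus half the total `e₁`-current `J̃(φ) = Σ_{x,σ} Im⟨φ, c†_{x+e₁,σ}c_{x,σ} φ⟩`. -/
def curX {L : ℕ} [NeZero L] (φ : Fock (Orb (FermionTorus 2 L))) : ℝ :=
  ∑ x : Site 2 L, ∑ σ : Fin 2,
    (star φ ⬝ᵥ ((creation (orb (FermionTorus.ofTorusSite (Site.shift x 0)) σ) *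
      annihilation (orb (FermionTorus.ofTorusSite x) σ)) *ᵥ φ)).im

/-- **Continuous-flux pricing (PROVED; tree identity on `fluxEnergy`)**: for every unit vector `φ`
of the admissible sector and EVERY real flux `Φ`,
`E^T_L(Φ) ≤ Re⟨φ,Hφ⟩ + 2(1 − cos(Φ/L)) K(φ) + 2 sin(Φ/L) J̃(φ)`.
Watanabe (2019) §2.2.1; tree `minEnergyOn_uniformTwistConfig_le_rayleigh`. [cite: Watanabe2019, §2.2.3 and §4.1] -/
theorem fluxEnergy_le_twistRayleigh {L : ℕ} [NeZero L] (hL : 3 ≤ L) (U δ Φ : ℝ)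
    (φ : Fock (Orb (FermionTorus 2 L))) (hφ : φ ∈ admSector L δ) (h1 : star φ ⬝ᵥ φ = 1) :
    fluxEnergy L U δ Φ ≤ (star φ ⬝ᵥ (hubbardTorus 2 L 1 U *ᵥ φ)).re +
      2 * (1 - Real.cos (Φ / L)) * kinX φ + 2 * Real.sin (Φ / L) * curX φ := by
  rw [fluxEnergy_eq_minEnergyOn_uniformTwistConfig hL]
  exact minEnergyOn_uniformTwistConfig_le_rayleigh hL U _ 0 Φ φ hφ h1

/-- **Optimised continuous-flux pricing (PROVED)**: if `K(φ) > 0`, some real flux undercuts the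
flux envelope by the full amplitude `2(√(K²+J̃²) − K) ≥ J̃²/(K + |J̃|)`:
`∃ Φ, E^T_L(Φ) ≤ Re⟨φ,Hφ⟩ + 2K − 2√(K² + J̃²)`. Unlike the integer Lieb–Schultz–Mattis twist
(Bloch), the linear current term always wins at small flux: no factor-two / odd-winding
marginality. Bohm (1949); Byers–Yang (1961). [folklore] -/
theorem fluxEnergy_le_of_current {L : ℕ} [NeZero L] (hL : 3 ≤ L) (U δ : ℝ)
    (φ : Fock (Orb (FermionTorus 2 L))) (hφ : φ ∈ admSector L δ) (h1 : star φ ⬝ᵥ φ = 1)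
    (hK : 0 < kinX φ) :
    ∃ Φ : ℝ, fluxEnergy L U δ Φ ≤ (star φ ⬝ᵥ (hubbardTorus 2 L 1 U *ᵥ φ)).re +
      2 * kinX φ - 2 * Real.sqrt (kinX φ ^ 2 + curX φ ^ 2) := by
  set K := kinX φ with hKdef
  set J := curX φ with hJdef
  set θ := Real.arctan (-J / K) with hθ
  have hLpos : (0 : ℝ) < L := Nat.cast_pos.2 (by omega)
  refine ⟨θ * L, ?_⟩
  have h := fluxEnergy_le_twistRayleigh hL U δ (θ * L) φ hφ h1
  rw [mul_div_assoc, div_self hLpos.ne', mul_one] at h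
  -- cos θ = K / R, sin θ = -J / R with R = √(K² + J²)
  have hK0 : K ≠ 0 := hK.ne'
  have hRpos : 0 < Real.sqrt (K ^ 2 + J ^ 2) := Real.sqrt_pos.2 (by positivity)
  have hRne : Real.sqrt (K ^ 2 + J ^ 2) ≠ 0 := hRpos.ne'
  have hfrac : (1 + (-J / K) ^ 2) = (K ^ 2 + J ^ 2) / K ^ 2 := by
    field_simp
  have hR : Real.sqrt (1 + (-J / K) ^ 2) = Real.sqrt (K ^ 2 + J ^ 2) / K := by
    rw [hfrac, Real.sqrt_div' _ (sq_nonneg K), Real.sqrt_sq hK.le]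
  have hcos : Real.cos θ = K / Real.sqrt (K ^ 2 + J ^ 2) := by
    rw [hθ, Real.cos_arctan, hR, one_div, inv_div]
  have hsin : Real.sin θ = -J / Real.sqrt (K ^ 2 + J ^ 2) := by
    rw [hθ, Real.sin_arctan, hR, div_div_eq_mul_div, div_mul_cancel₀ _ hK0]
  rw [hcos, hsin] at h
  have hsq : Real.sqrt (K ^ 2 + J ^ 2) ^ 2 = K ^ 2 + J ^ 2 := Real.sq_sqrt (by positivity)
  have hKJ : 2 * (1 - K / Real.sqrt (K ^ 2 + J ^ 2)) * K +
      2 * (-J / Real.sqrt (K ^ 2 + J ^ 2)) * J = 2 * K - 2 * Real.sqrt (K ^ 2 + J ^ 2) := by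
    have e1 : 2 * (1 - K / Real.sqrt (K ^ 2 + J ^ 2)) * K + 2 * (-J / Real.sqrt (K ^ 2 + J ^ 2)) * J
        = 2 * K - 2 * ((K ^ 2 + J ^ 2) / Real.sqrt (K ^ 2 + J ^ 2)) := by ring
    have e2 : (K ^ 2 + J ^ 2) / Real.sqrt (K ^ 2 + J ^ 2) = Real.sqrt (K ^ 2 + J ^ 2) := by
      rw [div_eq_iff hRne, ← sq, hsq]
    rw [e1, e2]
  linarith [h, hKJ]

/-- **(DIA) FLUX DIAMAGNETISM of the sector ground energy at weak coupling** (energies only; the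
SIGN half of FluxSpectroscopy's flux criterion `FC_T`, without rate): for every `δ` there is `U₁ > 0`
such that for all `U ∈ (0,U₁)` and every `γ > 0`, eventually in even `L`, `E^T_L(0) ≤ E^T_L(Φ) + γ`
for EVERY real flux `Φ` (by `fluxEnergy_periodic` it suffices on one period): threading flux never
lowers the sector ground energy by a fixed amount. Bosonic supplier: the diamagnetic inequality
(Lieb–Seiringer–Yngvason 2002, LSSY 2005 Thm 5.3); for fermions false at open-shell sides of the FREE
gas (shell paramagnetism, O(1)·|Φ|), expected true for `L ≫ ξ(U)` in a paired phase (Byers–Yang). -/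
def FluxDiamagnetism : Prop :=
  ∀ δ ∈ Set.Ioo (0:ℝ) (1 / 2), ∃ U₁ : ℝ, 0 < U₁ ∧ ∀ U ∈ Set.Ioo (0:ℝ) U₁,
    ∀ γ : ℝ, 0 < γ → ∃ L₀ : ℕ, ∀ (L : ℕ) [NeZero L], Even L → L₀ ≤ L →
      ∀ Φ : ℝ, fluxEnergy L U δ 0 ≤ fluxEnergy L U δ Φ + γ

/-- The signed first `e₁`-moment of the window pair weight,
`M₁(φ) = Σ_{m ≠ 0, |q_m| ≤ ε} sin(q_{m,1}) S_φ(m)`, `q_{m,1} = 2π·valMinAbs(m₁)/L`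
(calibration: the LSM-boosted condensate `G_jψ₀` has `M₁ = sin(4πj/L)·S(2jê₁)`). -/
def signedMoment (L : ℕ) [NeZero L] (ε : ℝ) (φ : Fock (Orb (FermionTorus 2 L))) : ℝ :=
  ∑ m : Fin 2 → ZMod L, if m ≠ 0 ∧ momentumNormSq L m ≤ ε ^ 2 then
    Real.sin (2 * Real.pi * ((m 0).valMinAbs : ℝ) / L) * pairStructureFactor dWaveFormFactor L φ m
  else 0

/-- Total low-momentum pair weight `REF_ε(φ) = S_φ(0) + W_ε(φ)` (zero mode plus window). -/
def lowWeight (L : ℕ) [NeZero L] (ε : ℝ) (φ : Fock (Orb (FermionTorus 2 L))) : ℝ :=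
  pairStructureFactor dWaveFormFactor L φ 0 + windowSum L ε φ

/-- **(LOCK) LONDON LOCKING ON THE O(1) SHELL** (constitutive; calibrated on the boost family with
`f = 1`): for every `δ` there is `U₁ > 0` such that for all `U ∈ (0,U₁)` there is a locking
fraction `f > 0` with: for every macroscopicity floor `θ₀ > 0` and slack `ϑ > 0` there are a shell
width `s > 0`, a window `ε₁ > 0` and, for each `ε ∈ (0, ε₁]`, an `L₀` such that every unit
admissible vector `φ` at even `L ≥ L₀` within `s` of the sector ground energy whose low-momentum
`d`-wave pair weight is macroscopic (`REF_ε(φ) ≥ θ₀L²`) carries `e₁`-current in proportion to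
the signed first moment of its window weight:
`|J̃(φ)|·REF_ε(φ) + ϑ L³ ≥ (f/2)·K(φ)·|M₁(φ)|`.
States with free blocking (Fulde–Ferrell quasiparticle backflow) violate it, but they are not on the
O(1) shell of the `S^z = 0` sector (counterflow costs ≥ c α^{3/2} √L for nodal `d`-wave). -/
def LondonLockingOnShell : Prop :=
  ∀ δ ∈ Set.Ioo (0:ℝ) (1 / 2), ∃ U₁ : ℝ, 0 < U₁ ∧ ∀ U ∈ Set.Ioo (0:ℝ) U₁,
    ∃ f : ℝ, 0 < f ∧ ∀ θ₀ : ℝ, 0 < θ₀ → ∀ ϑ : ℝ, 0 < ϑ → ∃ s : ℝ, 0 < s ∧ ∃ ε₁ : ℝ, 0 < ε₁ ∧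
      ∀ ε ∈ Set.Ioc (0:ℝ) ε₁, ∃ L₀ : ℕ, ∀ (L : ℕ) [NeZero L], Even L → L₀ ≤ L →
        ∀ φ : Fock (Orb (FermionTorus 2 L)), φ ∈ admSector L δ → star φ ⬝ᵥ φ = 1 →
          (star φ ⬝ᵥ (hubbardTorus 2 L 1 U *ᵥ φ)).re ≤
              (hubbardTorus 2 L 1 U).minEnergyOn (admSector L δ) + s →
            θ₀ * (L : ℝ) ^ 2 ≤ lowWeight L ε φ →
              f / 2 * kinX φ * |signedMoment L ε φ| ≤
                |curX φ| * lowWeight L ε φ + ϑ * (L : ℝ) ^ 3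

end

end Summit.HubbardSuperconductivity.HubbardSuperconductivity.Cruxes.NoInfraredPileUp.Ideator2
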